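import Summits.QuantumFields.BalabanUV.T4Continuum.Spine.NE7.Targets
import Summits.QuantumFields.YangMills.Theorems.BalabanUVNodesN19TargetClassWeightsTwoRunKeyed
import Literature.MathematicalPhysics.QuantumFieldTheory.Balaban1983to89.Node00.TwoRunSiteLift

/-!
# BalabanUVNodes ∕ N19 (NE7) — WHAT THE DISPLAYED HYPOTHESES `h21 ∧ hedge` OF N19's KEYED FACES FORCE ON UN-PARTNERED CLASSES:
# a good class carried by only ONE run is PURE SHELL; the un-partnered run-A terms have relative weight `≤ W_K + Wsh_K`;
# under a SECTION of the key maps no such class exists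

Cell `pub-ymgap` (HUMAN RULING D-0062, Track A), R134 seat `pub-ymgap-dag-n19-d` (gen 18), strategy s2 «by-name knit»; filed
`--kind proof --supports stmt-QuantumFields-20544 --as helper` (K3⁷ `SpineGivenEndpointR13SepCoPH`); COUNT-NEUTRAL.  Trigger: node00-def-RR-2 g14's
DESIGN WORD OF RECORD for node U5d (bus l.23429, 2026-08-27T21:20:28Z): option (b) ADOPTED (dag-n20-d `Node00/TwoRunSiteKey` p570161: `twoRunKeyA := seqKey`,
`twoRunKeyB := seqKey ∘ truncShift`), option (c) (`Node00/TwoRunSiteTransport` p561554, `truncSeq` under the displayed flow hypothesis `RAgree`) kept as (b)'s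
special case.  Consumers of record at N19's face: module B `…N19TargetClassWeightsTwoRunKeyed` (p571597, option (b)) and module C `…TruncSeq` (p571174, option (c)),
both instances of B‴ ∕ B⁗'s ★★ road `matching_scheme_of_coreEdge_keyedClassWeights_imageUnion(_liveRepin₁₃)` whose class set is `T K := univ.image (kA K) ∪ univ.image (kB K)`
and whose displayed hypotheses are N20's `h20 : RelWeightBound`, N21's `h21 : ShellWeightBound`, U4′'s `hlt` and N19's `hedge : ∃ δ, NE7.Core … (A − shA) (B − shB) δ ∧ Summable δ`.

WHAT THIS FILE RECORDS (RR-2's «WHAT (b) DOES NOT DO», made a tree theorem, AND ITS MIRROR IMAGE).  RR-2's word names the run-B-only keys `image kB ∖ image kA` (run-A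
weight `0`; «`h20`∕`h21` must cover them on the jump window of `RkOfRecord`»).  The displayed pair `h21 ∧ hedge` says MORE, on BOTH sides and in EVERY option: on a GOOD class
`x ∈ T K ∖ Bad K t` (`|t| ≤ l₀`)
* if run A's weight vanishes, `A K t x = 0`, then `0 ≤ shA ≤ A` kills run A's core and the sandwich `e^{c∓vol·δ_K}·0 ≶ B − shB` forces `B K t x = shB K t x` — the class is
  PURE SHELL in run B (§1 `right_eq_shell_of_left_eq_zero`);
* if run B's weight vanishes, `B K t x = 0`, then `0 ≤ shB ≤ B` kills run B's core and `e^{c−vol·δ_K}·(A − shA) ≤ 0` with `A − shA ≥ 0` forces `A K t x = shA K t x` — the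
  class is PURE SHELL in run A (§1 `left_eq_shell_of_right_eq_zero`);
* hence (§1 `sum_left_filter_right_eq_zero_le`) the run-A classes WITHOUT run-B weight have total weight `≤ (W K + Wsh K)·Σ_{T K} A` (bad part by `h20.bad_left`, good part
  pure shell by `h21.left`): a summable RELATIVE-WEIGHT obligation on the un-partnered run-A terms.
At keyed fibre-sum data (§2, any finite source types, any key maps, any term weights) «weight vanishes» ⇐ «key not hit» (`sum_filter_key_eq_zero_of_not_mem_image`), and the
obligation is VOID under a SECTION `lift K` of the key maps (`kB K (lift K s) = kA K s`, §2 `image_left_subset_image_right_of_section`).  At dag-n20-d's sigma-packed two-run site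
keys (§3; module B §1 `sum_filter_sigma_twoRunKeyA_eq`: run A's keyed class = ONE (2.18) term): every good run-A TERM whose key is not a `twoRunKeyB`-value is pure shell
(`term_left_eq_shell_of_not_mem_image_twoRunKeyB`); every good run-B block-down fibre over a key outside run A's image is pure shell (`fiber_right_eq_shell_of_not_mem_image_twoRunKeyA`,
RR-2's jump-window classes); and under `RAgree` the inclusion the tree has is `image kB ⊆ image kA` only (n20-d `range_twoRunKeyB_subset_of_rAgree`, B §1
`image_sigma_twoRunKeyA_union_eq_of_rAgree`) — the converse is SURJECTIVITY of `truncSeq`, displayed here as the hypothesis `hsurj` under which `image kA ⊆ image kB`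
(`image_sigma_twoRunKeyA_subset_of_truncSeq_surjective`) and the class set is run B's keyed image (`image_sigma_union_eq_image_twoRunKeyB_of_truncSeq_surjective`): then NO
one-sided class exists on either side and `hedge` is demanded on honestly two-sided classes only.  LOCATED (bus LOCATED-U5d-2): EITHER a section of the block-down on admissible
sequences under `RAgree` (geometry, n20-d's lane: lift by block-up, level-1 entries the whole torus) OR nodes N20 ∕ N21 book the un-partnered run-A terms — nothing in between.
RESOLVED ON THE `RAgree` ROAD the same hour: node00-def-RR-2 WORD-U5d-2 (bus l.23523) adopts the section («(α) ADOPTED, (β) declined»); dag-n20-d LANDED-1 (l.23657)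
`Node00/TwoRunSiteLift.lean` p575738 ✓ types it (`blockUpSet`, `liftSeq`, `truncSeq_liftSeq`, ★ `truncSeq_surjective`) — §4 applies it BY NAME: under `RAgree` alone
`univ.image kA ⊆ univ.image kB`, the two images coincide, every run-A term has a run-B partner class, and §2's un-partnered filter is EMPTY (LOCATED-U5d-2 (i)–(iii) VACUOUS on
the `RAgree` road); OFF `RAgree` the one-sided classes of BOTH kinds stay the bad-class ∕ shell obligation of the N20 ∕ N21 readings (WORD-U5d l.23429), which §1–§2 state as
theorems.

HONEST FRAMING — what this is NOT.  [folklore ∕ bookkeeping]: elementary consequences of the DISPLAYED hypothesis shapes `T4WeightBudget.RelWeightBound`,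
`T4IndicatorShell.ShellWeightBound`, `Spine.NE7.Core` and finite-sum bookkeeping; NO estimate is proved or asserted (NE7 ∕ NE7b ∕ NE7c are NOT PRINTED for d = 4 and NOT
proved; every such shape stays a HYPOTHESIS); no key map, section or surjectivity is constructed (hypotheses `lift`, `hsurj`); nothing of Bałaban's asserted; no
`Provisos₁₃…` inhabitant claimed (K0⁷ open); N19 NOT discharged (0∕1); K3⁷ NOT claimed; counts UNMOVED (typed 28∕28 · discharged 5∕27, A 5∕28).  One finite four-torus
programme at fixed `ε` — NOT ℝ⁴, NOT infinite volume, NOT OS, NOT a mass gap, NOT the Clay problem.  No `sorry`, no `axiom`, no `instance`, no `notation`, no `def`.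
Printed TEMPLATE of the hybrid split only: [King1986] (3.10)–(3.13) pp. 656–657; the (2.18) index: [Balaban1988Convergent] (2.1) p. 254, (2.18) p. 257.
-/

noncomputable section

namespace Summit.QuantumFields.YangMills.BalabanUVNodes.N19TargetKeyedUnpartnered

open scoped BigOperators
open Literature.MathematicalPhysics.QuantumFieldTheory.Balaban1983to89
open Literature.MathematicalPhysics.QuantumFieldTheory.Balaban1983to89.Node00
open T4Continuum B14.Eq218Concrete
open T4WeightBudget (RelWeightBound)
open T4IndicatorShell (ShellWeightBound)
open Summit.QuantumFields.BalabanUV.T4Continuum.Spine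
open Summit.QuantumFields.YangMills.BalabanUVNodes.N19TargetClassWeightsTwoRunKeyed

/-! ## §1 Abstract hybrid data: a good class with one run's weight zero is pure shell in the other run -/

section Abstract

variable {ι : Type*} [DecidableEq ι] {l₀ vol : ℝ} {T : ℕ → Finset ι} {A B shA shB : ℕ → ℝ → ι → ℝ}
  {Bad : ℕ → ℝ → Finset ι} {W Wsh δ : ℕ → ℝ}

/-- `NE7.Core` is ANTITONE in the class set: shrinking every `T K` (same bad classes) keeps the sandwich on the remaining good classes — restricting the keyed
face to the classes carried by both runs loses nothing of `hedge`. [folklore] [cite: King1986, (3.10)–(3.13) pp.656–657 (template)] -/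
theorem core_anti {T' : ℕ → Finset ι} {P Q : ℕ → ℝ → ι → ℝ} (hT : ∀ K, T' K ⊆ T K) (h : NE7.Core l₀ vol T Bad P Q δ) :
    NE7.Core l₀ vol T' Bad P Q δ := by
  intro K
  obtain ⟨c, hc⟩ := h K
  refine ⟨c, fun t ht τ hτ => hc t ht τ ?_⟩
  rw [Finset.mem_sdiff] at hτ ⊢
  exact ⟨hT K hτ.1, hτ.2⟩

omit [DecidableEq ι] in
/-- Under `ShellWeightBound` every run-A term weight is nonnegative (`0 ≤ shA ≤ A`). [folklore] [cite: King1986, (3.10)–(3.13) pp.656–657 (template)] -/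
theorem left_nonneg_of_shell (hSh : ShellWeightBound l₀ T A B shA shB Wsh) {K : ℕ} {t : ℝ} (ht : |t| ≤ l₀) {τ : ι} (hτ : τ ∈ T K) :
    0 ≤ A K t τ :=
  (hSh.sh_nonneg_left K t ht τ hτ).trans (hSh.sh_le_left K t ht τ hτ)

omit [DecidableEq ι] in
/-- Under `ShellWeightBound` every run-B term weight is nonnegative (`0 ≤ shB ≤ B`). [folklore] [cite: King1986, (3.10)–(3.13) pp.656–657 (template)] -/
theorem right_nonneg_of_shell (hSh : ShellWeightBound l₀ T A B shA shB Wsh) {K : ℕ} {t : ℝ} (ht : |t| ≤ l₀) {τ : ι} (hτ : τ ∈ T K) :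
    0 ≤ B K t τ :=
  (hSh.sh_nonneg_right K t ht τ hτ).trans (hSh.sh_le_right K t ht τ hτ)

/-- **A GOOD CLASS WITHOUT RUN-A WEIGHT IS PURE SHELL IN RUN B.**  If `h21 : ShellWeightBound` and N19's core sandwich `hedge` (shape `NE7.Core` on the cores `A − shA`,
`B − shB`) hold, then on every good class `τ ∈ T K ∖ Bad K t`, `|t| ≤ l₀`, with `A K t τ = 0` one has `B K t τ = shB K t τ`: `0 ≤ shA ≤ A = 0` makes run A's core `0`, and
`e^{c−vol·δ_K}·0 ≤ B − shB ≤ e^{c+vol·δ_K}·0`.  (RR-2's «run-B classes of run-A weight 0»: under (b) off `RAgree` they must be BAD or PURE SHELL — nothing in between.)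
[folklore] [cite: King1986, (3.10)–(3.13) pp.656–657 (template)] -/
theorem right_eq_shell_of_left_eq_zero (hSh : ShellWeightBound l₀ T A B shA shB Wsh)
    (hcore : NE7.Core l₀ vol T Bad (fun K t τ => A K t τ - shA K t τ) (fun K t τ => B K t τ - shB K t τ) δ)
    {K : ℕ} {t : ℝ} (ht : |t| ≤ l₀) {τ : ι} (hτ : τ ∈ T K \ Bad K t) (hA : A K t τ = 0) :
    B K t τ = shB K t τ := by
  have hτT : τ ∈ T K := (Finset.mem_sdiff.mp hτ).1
  have hshA : shA K t τ = 0 :=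
    le_antisymm ((hSh.sh_le_left K t ht τ hτT).trans_eq hA) (hSh.sh_nonneg_left K t ht τ hτT)
  obtain ⟨c, hc⟩ := hcore K
  obtain ⟨h₁, h₂⟩ := hc t ht τ hτ
  simp only [hA, hshA, sub_zero, mul_zero] at h₁ h₂
  linarith

/-- **A GOOD CLASS WITHOUT RUN-B WEIGHT IS PURE SHELL IN RUN A.**  Same hypotheses; on a good class with `B K t τ = 0` one has `A K t τ = shA K t τ`: `0 ≤ shB ≤ B = 0`
makes run B's core `0`, and `e^{c−vol·δ_K}·(A − shA) ≤ 0` with `e^{…} > 0`, `A − shA ≥ 0`.  (The MIRROR obligation: a run-A term whose class receives no run-B weight must be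
BAD or PURE SHELL.) [folklore] [cite: King1986, (3.10)–(3.13) pp.656–657 (template)] -/
theorem left_eq_shell_of_right_eq_zero (hSh : ShellWeightBound l₀ T A B shA shB Wsh)
    (hcore : NE7.Core l₀ vol T Bad (fun K t τ => A K t τ - shA K t τ) (fun K t τ => B K t τ - shB K t τ) δ)
    {K : ℕ} {t : ℝ} (ht : |t| ≤ l₀) {τ : ι} (hτ : τ ∈ T K \ Bad K t) (hB : B K t τ = 0) :
    A K t τ = shA K t τ := by
  have hτT : τ ∈ T K := (Finset.mem_sdiff.mp hτ).1
  have hshB : shB K t τ = 0 :=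
    le_antisymm ((hSh.sh_le_right K t ht τ hτT).trans_eq hB) (hSh.sh_nonneg_right K t ht τ hτT)
  have hP : 0 ≤ A K t τ - shA K t τ := sub_nonneg.mpr (hSh.sh_le_left K t ht τ hτT)
  obtain ⟨c, hc⟩ := hcore K
  obtain ⟨h₁, -⟩ := hc t ht τ hτ
  simp only [hB, hshB, sub_zero] at h₁
  have hP' : A K t τ - shA K t τ ≤ 0 :=
    le_of_mul_le_mul_left (h₁.trans_eq (mul_zero _).symm) (Real.exp_pos _)
  linarith

/-- **THE UN-PARTNERED RUN-A CLASSES HAVE RELATIVE WEIGHT `≤ W_K + Wsh_K`.**  With `h20 : RelWeightBound` as well: for `|t| ≤ l₀`,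
`Σ_{τ ∈ T K, B K t τ = 0} A K t τ ≤ (W K + Wsh K)·Σ_{τ ∈ T K} A K t τ` — the bad ones by `h20.bad_left` (term weights `≥ 0`), the good ones are pure shell
(`left_eq_shell_of_right_eq_zero`) and the total shell is `≤ Wsh K·Σ A` (`h21.left`).  A summable relative-weight obligation the displayed hypotheses impose on whatever
run-A terms the class matching leaves without a run-B partner. [folklore] [cite: King1986, (3.10)–(3.13) pp.656–657 (template)] -/
theorem sum_left_filter_right_eq_zero_le (hW : RelWeightBound l₀ T A B Bad W) (hSh : ShellWeightBound l₀ T A B shA shB Wsh)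
    (hcore : NE7.Core l₀ vol T Bad (fun K t τ => A K t τ - shA K t τ) (fun K t τ => B K t τ - shB K t τ) δ)
    {K : ℕ} {t : ℝ} (ht : |t| ≤ l₀) :
    ∑ τ ∈ (T K).filter (fun τ => B K t τ = 0), A K t τ ≤ (W K + Wsh K) * ∑ τ ∈ T K, A K t τ := by
  rw [← Finset.sum_filter_add_sum_filter_not ((T K).filter (fun τ => B K t τ = 0)) (fun τ => τ ∈ Bad K t), add_mul]
  refine add_le_add ?_ ?_
  · refine le_trans (Finset.sum_le_sum_of_subset_of_nonneg (fun τ hτ => (Finset.mem_filter.mp hτ).2)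
      (fun τ hτ _ => left_nonneg_of_shell hSh ht (hW.bad_subset K t ht hτ))) (hW.bad_left K t ht)
  · calc ∑ τ ∈ ((T K).filter (fun τ => B K t τ = 0)).filter (fun τ => τ ∉ Bad K t), A K t τ
        = ∑ τ ∈ ((T K).filter (fun τ => B K t τ = 0)).filter (fun τ => τ ∉ Bad K t), shA K t τ := by
          refine Finset.sum_congr rfl fun τ hτ => ?_
          obtain ⟨hτS, hτB⟩ := Finset.mem_filter.mp hτ
          obtain ⟨hτT, hB0⟩ := Finset.mem_filter.mp hτS
          exact left_eq_shell_of_right_eq_zero hSh hcore ht (Finset.mem_sdiff.mpr ⟨hτT, hτB⟩) hB0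
      _ ≤ ∑ τ ∈ T K, shA K t τ :=
          Finset.sum_le_sum_of_subset_of_nonneg
            (fun τ hτ => (Finset.mem_filter.mp (Finset.mem_filter.mp hτ).1).1)
            (fun τ hτ _ => hSh.sh_nonneg_left K t ht τ hτ)
      _ ≤ Wsh K * ∑ τ ∈ T K, A K t τ := hSh.left K t ht

end Abstract

/-! ## §2 Keyed fibre-sum term data: «weight zero» ⇐ «key not hit»; the obligation is void under a section of the key maps -/

section Keyed

variable {ι : Type*} [DecidableEq ι] {l₀ vol : ℝ} {σA σB : ℕ → Type*} [∀ K, Fintype (σA K)] [∀ K, Fintype (σB K)]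
  {T : ℕ → Finset ι} {kA : (K : ℕ) → σA K → ι} {kB : (K : ℕ) → σB K → ι}
  {wA : (K : ℕ) → ℝ → σA K → ℝ} {wB : (K : ℕ) → ℝ → σB K → ℝ}
  {shA shB : ℕ → ℝ → ι → ℝ} {Bad : ℕ → ℝ → Finset ι} {W Wsh δ : ℕ → ℝ}

/-- A key NOT HIT by a key map carries the fibre sum `0` (empty fibre). [folklore] [cite: Balaban1988Convergent, (2.18) p.257 (bookkeeping)] -/
theorem sum_filter_key_eq_zero_of_not_mem_image {σ : Type*} [Fintype σ] {β : Type*} [AddCommMonoid β] (k : σ → ι) (f : σ → β)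
    {x : ι} (hx : x ∉ Finset.univ.image k) :
    ∑ s ∈ Finset.univ.filter (fun s => k s = x), f s = 0 :=
  Finset.sum_eq_zero fun s hs => (hx (Finset.mem_image.mpr ⟨s, Finset.mem_univ s, (Finset.mem_filter.mp hs).2⟩)).elim

/-- **A GOOD CLASS OUTSIDE RUN A's KEY IMAGE IS PURE SHELL IN RUN B** (keyed form of `right_eq_shell_of_left_eq_zero`): for the keyed term data of B‴ ∕ B⁗ ∕ B ∕ C
(`A K t x = Σ_{s : kA K s = x} wA K t s`, `B K t x = Σ_{s' : kB K s' = x} wB K t s'`, any class sets `T K`), if `h21` and the core sandwich hold then on every good class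
`x ∉ univ.image (kA K)` the whole run-B fibre weight is shell: `Σ_{s' : kB K s' = x} wB K t s' = shB K t x`. [folklore]
[cite: King1986, (3.10)–(3.13) pp.656–657 (template); Balaban1988Convergent, (2.18) p.257 (bookkeeping)] -/
theorem fiber_right_eq_shell_of_not_mem_image_left
    (hSh : ShellWeightBound l₀ T (fun K t x => ∑ s ∈ Finset.univ.filter (fun s => kA K s = x), wA K t s)
      (fun K t x => ∑ s' ∈ Finset.univ.filter (fun s' => kB K s' = x), wB K t s') shA shB Wsh)
    (hcore : NE7.Core l₀ vol T Bad (fun K t x => (∑ s ∈ Finset.univ.filter (fun s => kA K s = x), wA K t s) - shA K t x)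
      (fun K t x => (∑ s' ∈ Finset.univ.filter (fun s' => kB K s' = x), wB K t s') - shB K t x) δ)
    {K : ℕ} {t : ℝ} (ht : |t| ≤ l₀) {x : ι} (hx : x ∈ T K \ Bad K t) (hxA : x ∉ Finset.univ.image (kA K)) :
    ∑ s' ∈ Finset.univ.filter (fun s' => kB K s' = x), wB K t s' = shB K t x :=
  right_eq_shell_of_left_eq_zero hSh hcore ht hx (sum_filter_key_eq_zero_of_not_mem_image (kA K) (wA K t) hxA)

/-- **A GOOD CLASS OUTSIDE RUN B's KEY IMAGE IS PURE SHELL IN RUN A** (keyed form of `left_eq_shell_of_right_eq_zero`): on every good class `x ∉ univ.image (kB K)` the whole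
run-A fibre weight is shell: `Σ_{s : kA K s = x} wA K t s = shA K t x`. [folklore]
[cite: King1986, (3.10)–(3.13) pp.656–657 (template); Balaban1988Convergent, (2.18) p.257 (bookkeeping)] -/
theorem fiber_left_eq_shell_of_not_mem_image_right
    (hSh : ShellWeightBound l₀ T (fun K t x => ∑ s ∈ Finset.univ.filter (fun s => kA K s = x), wA K t s)
      (fun K t x => ∑ s' ∈ Finset.univ.filter (fun s' => kB K s' = x), wB K t s') shA shB Wsh)
    (hcore : NE7.Core l₀ vol T Bad (fun K t x => (∑ s ∈ Finset.univ.filter (fun s => kA K s = x), wA K t s) - shA K t x)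
      (fun K t x => (∑ s' ∈ Finset.univ.filter (fun s' => kB K s' = x), wB K t s') - shB K t x) δ)
    {K : ℕ} {t : ℝ} (ht : |t| ≤ l₀) {x : ι} (hx : x ∈ T K \ Bad K t) (hxB : x ∉ Finset.univ.image (kB K)) :
    ∑ s ∈ Finset.univ.filter (fun s => kA K s = x), wA K t s = shA K t x :=
  left_eq_shell_of_right_eq_zero hSh hcore ht hx (sum_filter_key_eq_zero_of_not_mem_image (kB K) (wB K t) hxB)

/-- **THE RUN-A CLASSES OUTSIDE RUN B's KEY IMAGE HAVE RELATIVE WEIGHT `≤ W_K + Wsh_K`** (keyed form of `sum_left_filter_right_eq_zero_le`): with `h20` as well,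
`Σ_{x ∈ T K, x ∉ univ.image (kB K)} A K t x ≤ (W K + Wsh K)·Σ_{x ∈ T K} A K t x` for `|t| ≤ l₀`. [folklore]
[cite: King1986, (3.10)–(3.13) pp.656–657 (template); Balaban1988Convergent, (2.18) p.257 (bookkeeping)] -/
theorem sum_fiber_left_not_mem_image_right_le
    (hW : RelWeightBound l₀ T (fun K t x => ∑ s ∈ Finset.univ.filter (fun s => kA K s = x), wA K t s)
      (fun K t x => ∑ s' ∈ Finset.univ.filter (fun s' => kB K s' = x), wB K t s') Bad W)
    (hSh : ShellWeightBound l₀ T (fun K t x => ∑ s ∈ Finset.univ.filter (fun s => kA K s = x), wA K t s)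
      (fun K t x => ∑ s' ∈ Finset.univ.filter (fun s' => kB K s' = x), wB K t s') shA shB Wsh)
    (hcore : NE7.Core l₀ vol T Bad (fun K t x => (∑ s ∈ Finset.univ.filter (fun s => kA K s = x), wA K t s) - shA K t x)
      (fun K t x => (∑ s' ∈ Finset.univ.filter (fun s' => kB K s' = x), wB K t s') - shB K t x) δ)
    {K : ℕ} {t : ℝ} (ht : |t| ≤ l₀) :
    ∑ x ∈ (T K).filter (fun x => x ∉ Finset.univ.image (kB K)), ∑ s ∈ Finset.univ.filter (fun s => kA K s = x), wA K t s
      ≤ (W K + Wsh K) * ∑ x ∈ T K, ∑ s ∈ Finset.univ.filter (fun s => kA K s = x), wA K t s := by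
  refine le_trans (Finset.sum_le_sum_of_subset_of_nonneg (fun x hx => ?_) (fun x hx _ => ?_))
    (sum_left_filter_right_eq_zero_le hW hSh hcore ht)
  · obtain ⟨hxT, hxB⟩ := Finset.mem_filter.mp hx
    exact Finset.mem_filter.mpr ⟨hxT, sum_filter_key_eq_zero_of_not_mem_image (kB K) (wB K t) hxB⟩
  · exact left_nonneg_of_shell hSh ht (Finset.mem_filter.mp hx).1

/-- **UNDER A SECTION OF THE KEY MAPS NO RUN-A CLASS IS UN-PARTNERED**: if `lift K : σA K → σB K` satisfies `kB K (lift K s) = kA K s` (every run-A source has a run-B source over the same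
key — for node U5d: the block-up lift of admissible sequences, `truncSeq ∘ liftSeq = id`), then `univ.image (kA K) ⊆ univ.image (kB K)`, so the filter of `sum_fiber_left_not_mem_image_right_le`
misses run A's keys entirely. [folklore] [cite: Balaban1988Convergent, (2.18) p.257 (bookkeeping)] -/
theorem image_left_subset_image_right_of_section (lift : (K : ℕ) → σA K → σB K) (hlift : ∀ K s, kB K (lift K s) = kA K s) (K : ℕ) :
    Finset.univ.image (kA K) ⊆ Finset.univ.image (kB K) := by
  intro x hx
  obtain ⟨s, -, rfl⟩ := Finset.mem_image.mp hx
  exact Finset.mem_image.mpr ⟨lift K s, Finset.mem_univ _, hlift K s⟩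

end Keyed

/-! ## §3 At dag-n20-d's sigma-packed two-run site keys `s ↦ ⟨K, twoRunKeyA … s⟩`, `s' ↦ ⟨K, twoRunKeyB … s'⟩` (modules B ∕ C) -/

section TwoRunKeys

variable (F : T4Family) (ν : Stage7Numerics) (K₀ : ℕ) {M : ℕ} [∀ Kc, DecidableEq (SiteSeqKey F Kc)]

/-- **EVERY GOOD RUN-A (2.18) TERM WHOSE KEY IS NOT A `twoRunKeyB`-VALUE IS PURE SHELL.**  At the sigma-packed keys of module B §2 (class set `univ.image kA ∪ univ.image kB`,
run A's keyed class = ONE term by B §1 `sum_filter_sigma_twoRunKeyA_eq`), for ANY term weights `wA`, `wB` (in B §2: NODE 00's `classWeightOfDatum₉ …` of the two runs):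
if `h21` and the core sandwich hold, `|t| ≤ l₀`, and the key `⟨K, twoRunKeyA … s⟩` of a run-A sequence of record `s` is neither bad nor the key of any run-B sequence
(`⟨K, twoRunKeyB … s'⟩`), then `wA K t s = shA K t ⟨K, twoRunKeyA … s⟩`.  Under (b) AND under (c): `RAgree` supplies `image kB ⊆ image kA` only. [folklore]
[cite: King1986, (3.10)–(3.13) pp.656–657 (template); Balaban1988Convergent, (2.1) p.254, (2.18) p.257 (bookkeeping)] -/
theorem term_left_eq_shell_of_not_mem_image_twoRunKeyB (hM : 0 < M) (gA gB : ℕ → ℕ → ℝ)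
    (wA : (K : ℕ) → ℝ → SeqOfRecord F ν M (gA K) (K₀ + K) (K₀ + K) → ℝ) (wB : (K : ℕ) → ℝ → SeqOfRecord F ν M (gB K) (K₀ + K + 1) (K₀ + K + 1) → ℝ)
    {l₀ vol : ℝ} {shA shB : ℕ → ℝ → (Σ K, SiteSeqKey F (K₀ + K)) → ℝ} {Bad : ℕ → ℝ → Finset (Σ K, SiteSeqKey F (K₀ + K))} {Wsh δ : ℕ → ℝ}
    (hSh : ShellWeightBound l₀
      (fun K => Finset.univ.image (fun s : SeqOfRecord F ν M (gA K) (K₀ + K) (K₀ + K) =>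
          (⟨K, twoRunKeyA F ν M (gA K) (K₀ + K) (K₀ + K) s⟩ : Σ K, SiteSeqKey F (K₀ + K)))
        ∪ Finset.univ.image (fun s' : SeqOfRecord F ν M (gB K) (K₀ + K + 1) (K₀ + K + 1) =>
          (⟨K, twoRunKeyB F ν hM (gB K) (K₀ + K) (K₀ + K) s'⟩ : Σ K, SiteSeqKey F (K₀ + K))))
      (fun K t x => ∑ s ∈ Finset.univ.filter (fun s : SeqOfRecord F ν M (gA K) (K₀ + K) (K₀ + K) =>
          (⟨K, twoRunKeyA F ν M (gA K) (K₀ + K) (K₀ + K) s⟩ : Σ K, SiteSeqKey F (K₀ + K)) = x), wA K t s)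
      (fun K t x => ∑ s' ∈ Finset.univ.filter (fun s' : SeqOfRecord F ν M (gB K) (K₀ + K + 1) (K₀ + K + 1) =>
          (⟨K, twoRunKeyB F ν hM (gB K) (K₀ + K) (K₀ + K) s'⟩ : Σ K, SiteSeqKey F (K₀ + K)) = x), wB K t s') shA shB Wsh)
    (hcore : NE7.Core l₀ vol
      (fun K => Finset.univ.image (fun s : SeqOfRecord F ν M (gA K) (K₀ + K) (K₀ + K) =>
          (⟨K, twoRunKeyA F ν M (gA K) (K₀ + K) (K₀ + K) s⟩ : Σ K, SiteSeqKey F (K₀ + K)))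
        ∪ Finset.univ.image (fun s' : SeqOfRecord F ν M (gB K) (K₀ + K + 1) (K₀ + K + 1) =>
          (⟨K, twoRunKeyB F ν hM (gB K) (K₀ + K) (K₀ + K) s'⟩ : Σ K, SiteSeqKey F (K₀ + K)))) Bad
      (fun K t x => (∑ s ∈ Finset.univ.filter (fun s : SeqOfRecord F ν M (gA K) (K₀ + K) (K₀ + K) =>
          (⟨K, twoRunKeyA F ν M (gA K) (K₀ + K) (K₀ + K) s⟩ : Σ K, SiteSeqKey F (K₀ + K)) = x), wA K t s) - shA K t x)
      (fun K t x => (∑ s' ∈ Finset.univ.filter (fun s' : SeqOfRecord F ν M (gB K) (K₀ + K + 1) (K₀ + K + 1) =>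
          (⟨K, twoRunKeyB F ν hM (gB K) (K₀ + K) (K₀ + K) s'⟩ : Σ K, SiteSeqKey F (K₀ + K)) = x), wB K t s') - shB K t x) δ)
    {K : ℕ} {t : ℝ} (ht : |t| ≤ l₀) (s : SeqOfRecord F ν M (gA K) (K₀ + K) (K₀ + K))
    (hgood : (⟨K, twoRunKeyA F ν M (gA K) (K₀ + K) (K₀ + K) s⟩ : Σ K, SiteSeqKey F (K₀ + K)) ∉ Bad K t)
    (hmiss : (⟨K, twoRunKeyA F ν M (gA K) (K₀ + K) (K₀ + K) s⟩ : Σ K, SiteSeqKey F (K₀ + K))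
      ∉ Finset.univ.image (fun s' : SeqOfRecord F ν M (gB K) (K₀ + K + 1) (K₀ + K + 1) =>
          (⟨K, twoRunKeyB F ν hM (gB K) (K₀ + K) (K₀ + K) s'⟩ : Σ K, SiteSeqKey F (K₀ + K)))) :
    wA K t s = shA K t ⟨K, twoRunKeyA F ν M (gA K) (K₀ + K) (K₀ + K) s⟩ := by
  have h := fiber_left_eq_shell_of_not_mem_image_right
    (kA := fun K (s : SeqOfRecord F ν M (gA K) (K₀ + K) (K₀ + K)) =>
      (⟨K, twoRunKeyA F ν M (gA K) (K₀ + K) (K₀ + K) s⟩ : Σ K, SiteSeqKey F (K₀ + K)))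
    (kB := fun K (s' : SeqOfRecord F ν M (gB K) (K₀ + K + 1) (K₀ + K + 1)) =>
      (⟨K, twoRunKeyB F ν hM (gB K) (K₀ + K) (K₀ + K) s'⟩ : Σ K, SiteSeqKey F (K₀ + K))) hSh hcore ht
    (Finset.mem_sdiff.mpr ⟨Finset.mem_union_left _ (Finset.mem_image_of_mem _ (Finset.mem_univ s)), hgood⟩) hmiss
  rwa [sum_filter_sigma_twoRunKeyA_eq F ν K₀ M gA K (wA K t) s] at h

/-- **EVERY GOOD RUN-B BLOCK-DOWN FIBRE OVER A KEY OUTSIDE RUN A's IMAGE IS PURE SHELL** (RR-2's jump-window classes `image kB ∖ image kA`, by name): same data; if the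
key `⟨K, twoRunKeyB … s'⟩` of a run-B sequence of record `s'` is neither bad nor a `twoRunKeyA`-value, then the whole fibre weight
`Σ_{s'' : ⟨K, twoRunKeyB … s''⟩ = ⟨K, twoRunKeyB … s'⟩} wB K t s''` (B §1 `filter_sigma_twoRunKeyB_eq_filter_truncShift`: the `truncShift`-fibre of `s'`) equals
`shB K t ⟨K, twoRunKeyB … s'⟩`.  Under `RAgree` this case is EMPTY (B §1 `image_sigma_twoRunKeyA_union_eq_of_rAgree`). [folklore]
[cite: King1986, (3.10)–(3.13) pp.656–657 (template); Balaban1988Convergent, (2.1) p.254, (2.18) p.257 (bookkeeping)] -/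
theorem fiber_right_eq_shell_of_not_mem_image_twoRunKeyA (hM : 0 < M) (gA gB : ℕ → ℕ → ℝ)
    (wA : (K : ℕ) → ℝ → SeqOfRecord F ν M (gA K) (K₀ + K) (K₀ + K) → ℝ) (wB : (K : ℕ) → ℝ → SeqOfRecord F ν M (gB K) (K₀ + K + 1) (K₀ + K + 1) → ℝ)
    {l₀ vol : ℝ} {shA shB : ℕ → ℝ → (Σ K, SiteSeqKey F (K₀ + K)) → ℝ} {Bad : ℕ → ℝ → Finset (Σ K, SiteSeqKey F (K₀ + K))} {Wsh δ : ℕ → ℝ}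
    (hSh : ShellWeightBound l₀
      (fun K => Finset.univ.image (fun s : SeqOfRecord F ν M (gA K) (K₀ + K) (K₀ + K) =>
          (⟨K, twoRunKeyA F ν M (gA K) (K₀ + K) (K₀ + K) s⟩ : Σ K, SiteSeqKey F (K₀ + K)))
        ∪ Finset.univ.image (fun s' : SeqOfRecord F ν M (gB K) (K₀ + K + 1) (K₀ + K + 1) =>
          (⟨K, twoRunKeyB F ν hM (gB K) (K₀ + K) (K₀ + K) s'⟩ : Σ K, SiteSeqKey F (K₀ + K))))
      (fun K t x => ∑ s ∈ Finset.univ.filter (fun s : SeqOfRecord F ν M (gA K) (K₀ + K) (K₀ + K) =>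
          (⟨K, twoRunKeyA F ν M (gA K) (K₀ + K) (K₀ + K) s⟩ : Σ K, SiteSeqKey F (K₀ + K)) = x), wA K t s)
      (fun K t x => ∑ s' ∈ Finset.univ.filter (fun s' : SeqOfRecord F ν M (gB K) (K₀ + K + 1) (K₀ + K + 1) =>
          (⟨K, twoRunKeyB F ν hM (gB K) (K₀ + K) (K₀ + K) s'⟩ : Σ K, SiteSeqKey F (K₀ + K)) = x), wB K t s') shA shB Wsh)
    (hcore : NE7.Core l₀ vol
      (fun K => Finset.univ.image (fun s : SeqOfRecord F ν M (gA K) (K₀ + K) (K₀ + K) =>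
          (⟨K, twoRunKeyA F ν M (gA K) (K₀ + K) (K₀ + K) s⟩ : Σ K, SiteSeqKey F (K₀ + K)))
        ∪ Finset.univ.image (fun s' : SeqOfRecord F ν M (gB K) (K₀ + K + 1) (K₀ + K + 1) =>
          (⟨K, twoRunKeyB F ν hM (gB K) (K₀ + K) (K₀ + K) s'⟩ : Σ K, SiteSeqKey F (K₀ + K)))) Bad
      (fun K t x => (∑ s ∈ Finset.univ.filter (fun s : SeqOfRecord F ν M (gA K) (K₀ + K) (K₀ + K) =>
          (⟨K, twoRunKeyA F ν M (gA K) (K₀ + K) (K₀ + K) s⟩ : Σ K, SiteSeqKey F (K₀ + K)) = x), wA K t s) - shA K t x)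
      (fun K t x => (∑ s' ∈ Finset.univ.filter (fun s' : SeqOfRecord F ν M (gB K) (K₀ + K + 1) (K₀ + K + 1) =>
          (⟨K, twoRunKeyB F ν hM (gB K) (K₀ + K) (K₀ + K) s'⟩ : Σ K, SiteSeqKey F (K₀ + K)) = x), wB K t s') - shB K t x) δ)
    {K : ℕ} {t : ℝ} (ht : |t| ≤ l₀) (s' : SeqOfRecord F ν M (gB K) (K₀ + K + 1) (K₀ + K + 1))
    (hgood : (⟨K, twoRunKeyB F ν hM (gB K) (K₀ + K) (K₀ + K) s'⟩ : Σ K, SiteSeqKey F (K₀ + K)) ∉ Bad K t)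
    (hmiss : (⟨K, twoRunKeyB F ν hM (gB K) (K₀ + K) (K₀ + K) s'⟩ : Σ K, SiteSeqKey F (K₀ + K))
      ∉ Finset.univ.image (fun s : SeqOfRecord F ν M (gA K) (K₀ + K) (K₀ + K) =>
          (⟨K, twoRunKeyA F ν M (gA K) (K₀ + K) (K₀ + K) s⟩ : Σ K, SiteSeqKey F (K₀ + K)))) :
    ∑ s'' ∈ Finset.univ.filter (fun s'' : SeqOfRecord F ν M (gB K) (K₀ + K + 1) (K₀ + K + 1) =>
        (⟨K, twoRunKeyB F ν hM (gB K) (K₀ + K) (K₀ + K) s''⟩ : Σ K, SiteSeqKey F (K₀ + K))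
          = ⟨K, twoRunKeyB F ν hM (gB K) (K₀ + K) (K₀ + K) s'⟩), wB K t s''
      = shB K t ⟨K, twoRunKeyB F ν hM (gB K) (K₀ + K) (K₀ + K) s'⟩ :=
  fiber_right_eq_shell_of_not_mem_image_left
    (kA := fun K (s : SeqOfRecord F ν M (gA K) (K₀ + K) (K₀ + K)) =>
      (⟨K, twoRunKeyA F ν M (gA K) (K₀ + K) (K₀ + K) s⟩ : Σ K, SiteSeqKey F (K₀ + K)))
    (kB := fun K (s' : SeqOfRecord F ν M (gB K) (K₀ + K + 1) (K₀ + K + 1)) =>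
      (⟨K, twoRunKeyB F ν hM (gB K) (K₀ + K) (K₀ + K) s'⟩ : Σ K, SiteSeqKey F (K₀ + K))) hSh hcore ht
    (Finset.mem_sdiff.mpr ⟨Finset.mem_union_right _ (Finset.mem_image_of_mem _ (Finset.mem_univ s')), hgood⟩) hmiss

/-- **UNDER `RAgree` AND SURJECTIVITY OF `truncSeq`, RUN A's KEYS ARE RUN-B KEYS**: if every run-A sequence of record is the `RAgree`-truncation of some run-B sequence
(`hsurj : ∀ K, Function.Surjective (truncSeq F ν hM (hR K))` — DISPLAYED; dag-n20-d INTENT-1 `Node00/TwoRunSiteLift` (bus l.23524) lands its discharge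
`truncSeq_surjective` from the block-up SECTION `liftSeq`, RR-2 WORD-U5d-2 l.23523 «(α) ADOPTED»; then the knit is ONE application per `K`), then `univ.image kA ⊆ univ.image kB`
for the sigma-packed keys (via n20-d's `twoRunKeyB_eq_twoRunKeyA_truncSeq`): together with B §1 `image_sigma_twoRunKeyA_union_eq_of_rAgree` the two images COINCIDE and no class is un-partnered on either side.
[folklore] [cite: Balaban1988Convergent, (2.1) p.254, (2.5) p.255, (2.18) p.257 (bookkeeping)] -/
theorem image_sigma_twoRunKeyA_subset_of_truncSeq_surjective (hM : 0 < M) {gA gB : ℕ → ℕ → ℝ} (hR : ∀ K, RAgree F ν (gA K) (gB K) (K₀ + K))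
    (hsurj : ∀ K, Function.Surjective (truncSeq F ν hM (hR K) (K := K₀ + K))) (K : ℕ) :
    Finset.univ.image (fun s : SeqOfRecord F ν M (gA K) (K₀ + K) (K₀ + K) =>
        (⟨K, twoRunKeyA F ν M (gA K) (K₀ + K) (K₀ + K) s⟩ : Σ K, SiteSeqKey F (K₀ + K)))
      ⊆ Finset.univ.image (fun s' : SeqOfRecord F ν M (gB K) (K₀ + K + 1) (K₀ + K + 1) =>
        (⟨K, twoRunKeyB F ν hM (gB K) (K₀ + K) (K₀ + K) s'⟩ : Σ K, SiteSeqKey F (K₀ + K))) :=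
  image_left_subset_image_right_of_section
    (kA := fun K (s : SeqOfRecord F ν M (gA K) (K₀ + K) (K₀ + K)) =>
      (⟨K, twoRunKeyA F ν M (gA K) (K₀ + K) (K₀ + K) s⟩ : Σ K, SiteSeqKey F (K₀ + K)))
    (kB := fun K (s' : SeqOfRecord F ν M (gB K) (K₀ + K + 1) (K₀ + K + 1)) =>
      (⟨K, twoRunKeyB F ν hM (gB K) (K₀ + K) (K₀ + K) s'⟩ : Σ K, SiteSeqKey F (K₀ + K)))
    (fun K s => Classical.choose (hsurj K s)) (fun K s => by
      show (⟨K, twoRunKeyB F ν hM (gB K) (K₀ + K) (K₀ + K) (Classical.choose (hsurj K s))⟩ : Σ K, SiteSeqKey F (K₀ + K))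
          = ⟨K, twoRunKeyA F ν M (gA K) (K₀ + K) (K₀ + K) s⟩
      rw [sigma_twoRunKeyB_eq_sigma_twoRunKeyA_truncSeq F ν K₀ hM (hR K), Classical.choose_spec (hsurj K s)]) K

/-- … hence under `RAgree ∧ hsurj` THE CLASS SET OF B ∕ C IS RUN B's KEYED IMAGE (and run A's, B §1): `univ.image kA ∪ univ.image kB = univ.image kB` — every class of the
keyed face is carried by BOTH runs, and `hedge` ∕ `h20` ∕ `h21` are demanded on honestly two-sided classes only. [folklore]
[cite: Balaban1988Convergent, (2.1) p.254, (2.5) p.255, (2.18) p.257 (bookkeeping)] -/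
theorem image_sigma_union_eq_image_twoRunKeyB_of_truncSeq_surjective (hM : 0 < M) {gA gB : ℕ → ℕ → ℝ}
    (hR : ∀ K, RAgree F ν (gA K) (gB K) (K₀ + K))
    (hsurj : ∀ K, Function.Surjective (truncSeq F ν hM (hR K) (K := K₀ + K))) (K : ℕ) :
    Finset.univ.image (fun s : SeqOfRecord F ν M (gA K) (K₀ + K) (K₀ + K) =>
        (⟨K, twoRunKeyA F ν M (gA K) (K₀ + K) (K₀ + K) s⟩ : Σ K, SiteSeqKey F (K₀ + K)))
      ∪ Finset.univ.image (fun s' : SeqOfRecord F ν M (gB K) (K₀ + K + 1) (K₀ + K + 1) =>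
        (⟨K, twoRunKeyB F ν hM (gB K) (K₀ + K) (K₀ + K) s'⟩ : Σ K, SiteSeqKey F (K₀ + K)))
      = Finset.univ.image (fun s' : SeqOfRecord F ν M (gB K) (K₀ + K + 1) (K₀ + K + 1) =>
        (⟨K, twoRunKeyB F ν hM (gB K) (K₀ + K) (K₀ + K) s'⟩ : Σ K, SiteSeqKey F (K₀ + K))) :=
  Finset.union_eq_right.mpr (image_sigma_twoRunKeyA_subset_of_truncSeq_surjective F ν K₀ hM hR hsurj K)

/-! ## §4 Under the displayed `RAgree` ALONE (dag-n20-d `Node00/TwoRunSiteLift` p575738 ✓: the block-up SECTION `liftSeq`, ★ `truncSeq_surjective`): no run-A term is un-partnered — §3's `hsurj` discharged BY NAME -/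

/-- **UNDER `RAgree`, RUN A's SIGMA-PACKED KEYS ARE RUN-B KEYS — NO FURTHER HYPOTHESIS**: `univ.image kA ⊆ univ.image kB`, §3's
`image_sigma_twoRunKeyA_subset_of_truncSeq_surjective` with `hsurj := fun K => truncSeq_surjective F ν hM (hR K)` (dag-n20-d's section, ONE application per cutoff).
[folklore] [cite: Balaban1988Convergent, (2.1) p.254, (2.5) p.255, (2.18) p.257 (bookkeeping)] -/
theorem image_sigma_twoRunKeyA_subset_of_rAgree (hM : 0 < M) {gA gB : ℕ → ℕ → ℝ} (hR : ∀ K, RAgree F ν (gA K) (gB K) (K₀ + K)) (K : ℕ) :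
    Finset.univ.image (fun s : SeqOfRecord F ν M (gA K) (K₀ + K) (K₀ + K) =>
        (⟨K, twoRunKeyA F ν M (gA K) (K₀ + K) (K₀ + K) s⟩ : Σ K, SiteSeqKey F (K₀ + K)))
      ⊆ Finset.univ.image (fun s' : SeqOfRecord F ν M (gB K) (K₀ + K + 1) (K₀ + K + 1) =>
        (⟨K, twoRunKeyB F ν hM (gB K) (K₀ + K) (K₀ + K) s'⟩ : Σ K, SiteSeqKey F (K₀ + K))) :=
  image_sigma_twoRunKeyA_subset_of_truncSeq_surjective F ν K₀ hM hR (fun K => truncSeq_surjective F ν hM (hR K)) K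

/-- **UNDER `RAgree` THE CLASS SET OF B ∕ C IS ONE KEYED IMAGE, READ FROM EITHER RUN**: `univ.image kA ∪ univ.image kB = univ.image kB` (this file) `= univ.image kA`
(B §1 `image_sigma_twoRunKeyA_union_eq_of_rAgree`) — the two-run class matching of node U5d is honestly TWO-SIDED: no class of N19's keyed face is carried by one run only.
[folklore] [cite: Balaban1988Convergent, (2.1) p.254, (2.5) p.255, (2.18) p.257 (bookkeeping)] -/
theorem image_sigma_twoRunKeyB_eq_image_sigma_twoRunKeyA_of_rAgree (hM : 0 < M) {gA gB : ℕ → ℕ → ℝ}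
    (hR : ∀ K, RAgree F ν (gA K) (gB K) (K₀ + K)) (K : ℕ) :
    Finset.univ.image (fun s' : SeqOfRecord F ν M (gB K) (K₀ + K + 1) (K₀ + K + 1) =>
        (⟨K, twoRunKeyB F ν hM (gB K) (K₀ + K) (K₀ + K) s'⟩ : Σ K, SiteSeqKey F (K₀ + K)))
      = Finset.univ.image (fun s : SeqOfRecord F ν M (gA K) (K₀ + K) (K₀ + K) =>
        (⟨K, twoRunKeyA F ν M (gA K) (K₀ + K) (K₀ + K) s⟩ : Σ K, SiteSeqKey F (K₀ + K))) := by
  rw [← Finset.union_eq_right.mpr (image_sigma_twoRunKeyA_subset_of_rAgree F ν K₀ hM hR K)]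
  exact image_sigma_twoRunKeyA_union_eq_of_rAgree F ν K₀ hM (hR K)

/-- **UNDER `RAgree` EVERY RUN-A TERM HAS A RUN-B PARTNER CLASS**: the key `⟨K, twoRunKeyA … s⟩` of every run-A sequence of record lies in `univ.image kB` — the hypothesis
`hmiss` of §3's `term_left_eq_shell_of_not_mem_image_twoRunKeyB` is NEVER met on the `RAgree` road (LOCATED-U5d-2 (ii) vacuous there). [folklore]
[cite: Balaban1988Convergent, (2.1) p.254, (2.5) p.255, (2.18) p.257 (bookkeeping)] -/
theorem sigma_twoRunKeyA_mem_image_twoRunKeyB_of_rAgree (hM : 0 < M) {gA gB : ℕ → ℕ → ℝ} (hR : ∀ K, RAgree F ν (gA K) (gB K) (K₀ + K))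
    (K : ℕ) (s : SeqOfRecord F ν M (gA K) (K₀ + K) (K₀ + K)) :
    (⟨K, twoRunKeyA F ν M (gA K) (K₀ + K) (K₀ + K) s⟩ : Σ K, SiteSeqKey F (K₀ + K))
      ∈ Finset.univ.image (fun s' : SeqOfRecord F ν M (gB K) (K₀ + K + 1) (K₀ + K + 1) =>
        (⟨K, twoRunKeyB F ν hM (gB K) (K₀ + K) (K₀ + K) s'⟩ : Σ K, SiteSeqKey F (K₀ + K))) :=
  image_sigma_twoRunKeyA_subset_of_rAgree F ν K₀ hM hR K (Finset.mem_image_of_mem _ (Finset.mem_univ s))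

/-- **UNDER `RAgree` THE UN-PARTNERED FILTER OF §2's BUDGET IS EMPTY**: no class of `univ.image kA ∪ univ.image kB` lies outside `univ.image kB`, so the left-hand sum of
`sum_fiber_left_not_mem_image_right_le` at N19's keyed face is over `∅` (LOCATED-U5d-2 (iii) vacuous; option (β) never owed on the `RAgree` road — RR-2 WORD-U5d-2).
[folklore] [cite: Balaban1988Convergent, (2.1) p.254, (2.5) p.255, (2.18) p.257 (bookkeeping)] -/
theorem filter_not_mem_image_twoRunKeyB_eq_empty_of_rAgree (hM : 0 < M) {gA gB : ℕ → ℕ → ℝ} (hR : ∀ K, RAgree F ν (gA K) (gB K) (K₀ + K)) (K : ℕ) :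
    (Finset.univ.image (fun s : SeqOfRecord F ν M (gA K) (K₀ + K) (K₀ + K) =>
          (⟨K, twoRunKeyA F ν M (gA K) (K₀ + K) (K₀ + K) s⟩ : Σ K, SiteSeqKey F (K₀ + K)))
        ∪ Finset.univ.image (fun s' : SeqOfRecord F ν M (gB K) (K₀ + K + 1) (K₀ + K + 1) =>
          (⟨K, twoRunKeyB F ν hM (gB K) (K₀ + K) (K₀ + K) s'⟩ : Σ K, SiteSeqKey F (K₀ + K)))).filter
        (fun x => x ∉ Finset.univ.image (fun s' : SeqOfRecord F ν M (gB K) (K₀ + K + 1) (K₀ + K + 1) =>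
          (⟨K, twoRunKeyB F ν hM (gB K) (K₀ + K) (K₀ + K) s'⟩ : Σ K, SiteSeqKey F (K₀ + K))))
      = ∅ := by
  refine Finset.filter_eq_empty_iff.mpr fun x hx hxB => hxB ?_
  rw [Finset.union_eq_right.mpr (image_sigma_twoRunKeyA_subset_of_rAgree F ν K₀ hM hR K)] at hx
  exact hx

end TwoRunKeys

end Summit.QuantumFields.YangMills.BalabanUVNodes.N19TargetKeyedUnpartnered

end
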